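import Literature.GroupTheory.CombinatorialGroupTheory.PuncturedSurfaceGroupCuspTwist
import Literature.AnabelianGeometry.SemiGraphs.PSCSeparatingCoveringsClosedSurfaceEdges
import HarnessLib

/-!
# [CombGC] Prop. 1.2, proof p. 9: the cusp twist transferred along a pro-`Σ` completion — separating a level cusp from the other level cusps and from the plain letters

Mochizuki, *A combinatorial version of the Grothendieck conjecture* [CombGC], PROOF of Prop. 1.2, p. 9, the
resp'd (edge) case ("there exists a finite étale … `Π_G`-covering `G' → G` whose restriction to the anabelioid
`G_{e₂}` is trivial …, but whose restriction to the anabelioid `G_{e₁}` is nontrivial … by gluing together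
appropriate finite étale coverings of the anabelioids `G_v`, `G_e`") [cite: MochizukiCombGC2007, Prop 1.2 proof p.9].

PROOF-ONLY file (abc-iut-f-060 gen 9; row «NODE-RESIDUAL@UNMARKED», census stratum (4) of abc-iut-L3-lead δ11; 0
definitions).  The discrete CUSP TWIST `PuncturedSurfaceGroup.exists_levelHom_cuspTwist`
(`PuncturedSurfaceGroupCuspTwist.lean`: `c_0` twisted, the last handle cancelling, all other letters plain) is
packaged (`exists_normal_separating_cuspTwist`) and transferred along a pro-`Σ` completion `ι : Γ_{g,r} → Π`
(Heisenberg group mod `ℓ^{[Γ:K]³}`, `ℓ ∈ Σ`; abc-iut-w5-d047's `exists_open_unrSeparating_of_discrete`):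

* `IsProSigmaCompletion.cuspTwist_exists_open_separating_sameCusp` — two DISTINCT level cusps
  `Vγ₁cl ι⟨c_0⟩ ≠ Vγ₂cl ι⟨c_0⟩` over the cusp `c_0` are separated (alive: `γ₁`; killed: `γ₂`);
* `IsProSigmaCompletion.cuspTwist_exists_open_separating_of_plain` — the level cusp `Vγ₁cl ι⟨c_0⟩` is separated
  from EVERY level conjugate `Vγ₂cl ι(H)` of a subgroup `H` generated by plain letters `a_i, b_i (i < g − 1)`,
  `c_j (j ≠ 0)` — e.g. from the loop node `cl ι⟨b_0⟩` of the one-cusp irreducible nodal carrier (`g ≥ 2`).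

Consumer: `PSCSeparatingCoveringsIrreducibleNodalOneCuspEdges.lean`.  Nothing here takes a side on [IUTchIII]
Cor. 3.12.
-/

noncomputable section

/-! ### The separating level of the cusp twist (discrete packaging) -/

namespace Literature.GroupTheory.CombinatorialGroupTheory.PuncturedSurfaceGroup

open scoped Pointwise

variable {g r : ℕ}

/-- **Separating level for a cusp** ([CombGC] Prop. 1.2 proof p. 9, edge case, discrete form): in the setting of
`exists_levelHom_cuspTwist` with `M` finite, some `U ⊴ N` with `[N : U] ∣ |M|` misses an element of
`f₁⟨c_0⟩f₁⁻¹ ∩ N`, contains `f₂⟨c_0⟩f₂⁻¹ ∩ N` whenever `f₁⁻¹ f₂ ∉ ⟨c_0⟩·N`, and contains `f H f⁻¹ ∩ N` for every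
`f` and the subgroup `H` generated by the plain letters. [cite: MochizukiCombGC2007, Prop 1.2 proof p.9] -/
theorem exists_normal_separating_cuspTwist (hg : 1 ≤ g) (hr : 1 ≤ r)
    (N : Subgroup (PuncturedSurfaceGroup g r)) [hN : N.Normal] [N.FiniteIndex]
    {M : Type*} [Group M] [Finite M] {X Y Z : M} (hXYZ : X * Y * X⁻¹ * Y⁻¹ = Z)
    (hZ : Z ∈ Subgroup.center M) {q : ℕ} (hZq : ∀ m : ℕ, Z ^ m = 1 ↔ q ∣ m) (hq : N.index ^ 3 < q)
    (f₁ : PuncturedSurfaceGroup g r) :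
    ∃ U : Subgroup N, U.Normal ∧ U.index ∣ Nat.card M ∧ U.FiniteIndex ∧
      (∃ z ∈ (ConjAct.toConjAct f₁ • Subgroup.zpowers (c (g := g) (⟨0, hr⟩ : Fin r))) ⊓ N,
        z ∉ U.map N.subtype) ∧
      (∀ f₂ : PuncturedSurfaceGroup g r,
        f₁⁻¹ * f₂ ∉ (Subgroup.zpowers (c (g := g) (⟨0, hr⟩ : Fin r)) : Set (PuncturedSurfaceGroup g r)) *
            (N : Set (PuncturedSurfaceGroup g r)) →
        (ConjAct.toConjAct f₂ • Subgroup.zpowers (c (g := g) (⟨0, hr⟩ : Fin r))) ⊓ N ≤ U.map N.subtype) ∧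
      ∀ f : PuncturedSurfaceGroup g r,
        (ConjAct.toConjAct f • Subgroup.closure {s : PuncturedSurfaceGroup g r |
          (∃ i : Fin g, (i : ℕ) < g - 1 ∧ (s = a i ∨ s = b i)) ∨ ∃ j : Fin r, (j : ℕ) ≠ 0 ∧ s = c j}) ⊓ N ≤
          U.map N.subtype := by
  classical
  obtain ⟨ψ, halive, hkill, hplain⟩ := exists_levelHom_cuspTwist hg hr N hXYZ hZ hZq hq f₁
  have hconj : ∀ (A : Subgroup (PuncturedSurfaceGroup g r)) (f z : PuncturedSurfaceGroup g r),
      z ∈ (ConjAct.toConjAct f • A) ⊓ N → ∃ y ∈ A, z = f * y * f⁻¹ := by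
    intro A f z hz
    obtain ⟨y, hyA, hyz⟩ := (Subgroup.mem_smul_pointwise_iff_exists _ _ _).mp (Subgroup.mem_inf.mp hz).1
    exact ⟨y, hyA, by rw [← hyz, ConjAct.smul_def, ConjAct.ofConjAct_toConjAct]⟩
  refine ⟨ψ.ker, inferInstance, ?_, ?_, ?_, ?_, ?_⟩
  · rw [Subgroup.index_ker]
    exact Subgroup.card_subgroup_dvd_card ψ.range
  · exact ⟨fun h0 => (Nat.card_pos (α := ψ.range)).ne' (by rwa [Subgroup.index_ker] at h0)⟩
  · refine ⟨f₁ * c ⟨0, hr⟩ ^ N.index * f₁⁻¹,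
      Subgroup.mem_inf.mpr ⟨?_, hN.conj_mem _ (Subgroup.pow_index_mem N _) f₁⟩, fun hmem => ?_⟩
    · rw [Subgroup.mem_smul_pointwise_iff_exists]
      exact ⟨c ⟨0, hr⟩ ^ N.index, Subgroup.npow_mem_zpowers _ _, by
        rw [ConjAct.smul_def, ConjAct.ofConjAct_toConjAct]⟩
    · obtain ⟨u, hu, hu'⟩ := Subgroup.mem_map.mp hmem
      refine halive ?_
      rw [← show u = ⟨f₁ * c ⟨0, hr⟩ ^ N.index * f₁⁻¹, hN.conj_mem _ (Subgroup.pow_index_mem N _) f₁⟩ from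
        Subtype.ext hu']
      exact hu
  · intro f₂ hf₂ z hz
    exact Subgroup.mem_map.mpr ⟨⟨z, hz.2⟩, hkill f₂ hf₂ z hz, rfl⟩
  · intro f z hz
    obtain ⟨y, hy, hzy⟩ := hconj _ f z hz
    have hz2 : f * y * f⁻¹ ∈ N := hzy ▸ (Subgroup.mem_inf.mp hz).2
    refine Subgroup.mem_map.mpr ⟨⟨f * y * f⁻¹, hz2⟩, hplain f y hy hz2, hzy.symm⟩

end Literature.GroupTheory.CombinatorialGroupTheory.PuncturedSurfaceGroup

namespace Literature.AnabelianGeometry.SemiGraphs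

open scoped Pointwise
open Literature.AnabelianGeometry.Anabelioids (IsSigmaInteger)
open Literature.GroupTheory.CombinatorialGroupTheory
open Literature.GroupTheory.CombinatorialGroupTheory.PuncturedSurfaceGroup (a b c exists_normal_separating_cuspTwist)

/-! ### The transfers -/

namespace SemiGraphOfAnabelioids.IsProSigmaCompletion

variable {Sigma : Set ℕ} {g r : ℕ} {P : Type*} [Group P] [TopologicalSpace P] [IsTopologicalGroup P]
  [CompactSpace P] [TotallyDisconnectedSpace P] {ι : PuncturedSurfaceGroup g r →* P}

/-- **The cusp-twist transfer, general killed subgroup.**  `ι : Γ_{g,r} → Π` a pro-`Σ` completion (`Π`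
profinite), `g, r ≥ 1`, `A = cl ι⟨c_0⟩`, `ℓ ∈ Σ` prime, `V ⊴ Π` open, `f₁ f₂ ∈ Γ`, `Hk ≤ Γ`; if at the level
`K = ι⁻¹(V)` every `(f₂ Hk f₂⁻¹) ∩ K` is killed by the cusp twist at `f₁` — i.e. `Hk = ⟨c_0⟩` with
`f₁⁻¹f₂ ∉ ⟨c_0⟩K`, or `Hk` generated by plain letters — then some open `U ≤ V`, normal in `V`, contains
`ι(f₂) cl ι(Hk) ι(f₂)⁻¹ ∩ V` and not `ι(f₁) A ι(f₁)⁻¹ ∩ V`. [cite: MochizukiCombGC2007, Prop 1.2 proof p.9] -/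
theorem cuspTwist_exists_open_separating (hι : IsProSigmaCompletion Sigma ι) (hg : 1 ≤ g) (hr : 1 ≤ r)
    {ℓ : ℕ} (hℓ : ℓ.Prime) (hℓS : ℓ ∈ Sigma) (V : Subgroup P) [hVn : V.Normal] (hVo : IsOpen (V : Set P))
    (f₁ f₂ : PuncturedSurfaceGroup g r) (Hk : Subgroup (PuncturedSurfaceGroup g r))
    (hHk : Hk ≤ Subgroup.closure {s : PuncturedSurfaceGroup g r |
          (∃ i : Fin g, (i : ℕ) < g - 1 ∧ (s = a i ∨ s = b i)) ∨ ∃ j : Fin r, (j : ℕ) ≠ 0 ∧ s = c j} ∨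
      (Hk = Subgroup.zpowers (c (g := g) (⟨0, hr⟩ : Fin r)) ∧
        f₁⁻¹ * f₂ ∉ (Subgroup.zpowers (c (g := g) (⟨0, hr⟩ : Fin r)) : Set (PuncturedSurfaceGroup g r)) *
          (V.comap ι : Set _))) :
    ∃ U : Subgroup P, IsOpen (U : Set P) ∧ U ≤ V ∧ (U.subgroupOf V).Normal ∧
      (ConjAct.toConjAct (ι f₂) • (Hk.map ι).topologicalClosure) ⊓ V ≤ U ∧
      ¬ ((ConjAct.toConjAct (ι f₁) • ((Subgroup.zpowers (c (g := g) (⟨0, hr⟩ : Fin r))).map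
        ι).topologicalClosure) ⊓ V ≤ U) := by
  classical
  set x : PuncturedSurfaceGroup g r := c ⟨0, hr⟩ with hxdef
  haveI hKfi : (V.comap ι).FiniteIndex := finiteIndex_comap hι V hVo
  set m : ℕ := (V.comap ι).index with hm
  -- the Heisenberg group mod `q = ℓ^{m³}`
  set q : ℕ := ℓ ^ (m ^ 3) with hq
  have hmq : m ^ 3 < q := Nat.lt_pow_self hℓ.one_lt
  obtain ⟨φ, X, Y, Z, hXYZ, hZc, hZq, hcard⟩ := Heisenberg.exists_heisenbergTriple_central q
  haveI : Finite (Multiplicative (ZMod q × ZMod q) ⋊[φ] Multiplicative (ZMod q)) :=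
    Nat.finite_of_card_ne_zero (by rw [hcard]; exact pow_ne_zero _ (pow_ne_zero _ hℓ.ne_zero))
  -- the cusp twist at the discrete level `K = ι⁻¹(V)`
  obtain ⟨U', hU'n, hidx, hfi, halive, hkill, hplain⟩ :=
    exists_normal_separating_cuspTwist hg hr (V.comap ι) hXYZ hZc hZq (by rw [← hm]; exact hmq) f₁
  haveI := hU'n
  have hU'S : IsSigmaInteger Sigma U'.index := by
    rw [hcard, hq, ← pow_mul] at hidx
    exact ⟨Nat.pos_of_ne_zero hfi.index_ne_zero, fun p hp hpd =>
      (isSigmaInteger_prime_pow hℓ hℓS _).2 p hp (hpd.trans hidx)⟩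
  have hk : ((ConjAct.toConjAct f₂ • Hk) ⊔ ⊥) ⊓ V.comap ι ≤ U'.map (V.comap ι).subtype := by
    rw [sup_bot_eq]
    rcases hHk with hle | ⟨rfl, hδ⟩
    · exact le_trans (inf_le_inf_right _ (Subgroup.pointwise_smul_le_pointwise_smul_iff.mpr hle)) (hplain f₂)
    · exact hkill f₂ hδ
  -- transfer along the completion `V` of `K`
  obtain ⟨U, hUo, hUV, hUn, hk', ha⟩ :=
    exists_open_unrSeparating_of_discrete hι (Subgroup.zpowers x) Hk ⊥ V hVo f₁ f₂ U' hU'S hk halive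
  refine ⟨U, hUo, hUV, hUn, le_trans (inf_le_inf_right V le_sup_left) hk', ha⟩

/-- **Same cusp**: two DISTINCT level cusps `Vγ₁A ≠ Vγ₂A` over `c_0` (`A = cl ι⟨c_0⟩`) are separated by an
open `U ≤ V`, normal in `V`: `γ₂Aγ₂⁻¹ ∩ V ≤ U`, `γ₁Aγ₁⁻¹ ∩ V ⊄ U`. [cite: MochizukiCombGC2007, Prop 1.2 proof p.9] -/
theorem cuspTwist_exists_open_separating_sameCusp (hι : IsProSigmaCompletion Sigma ι) (hg : 1 ≤ g)
    (hr : 1 ≤ r) {ℓ : ℕ} (hℓ : ℓ.Prime) (hℓS : ℓ ∈ Sigma)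
    (A : Subgroup P) (hA : A = ((Subgroup.zpowers (c (g := g) (⟨0, hr⟩ : Fin r))).map ι).topologicalClosure)
    (V : Subgroup P) [hVn : V.Normal] (hVo : IsOpen (V : Set P)) (γ₁ γ₂ : ConjAct P)
    (hne : DoubleCoset.doubleCoset (ConjAct.ofConjAct γ₁) (V : Set P) (A : Set P) ≠
      DoubleCoset.doubleCoset (ConjAct.ofConjAct γ₂) (V : Set P) (A : Set P)) :
    ∃ U : Subgroup P, IsOpen (U : Set P) ∧ U ≤ V ∧ (U.subgroupOf V).Normal ∧
      (γ₂ • A) ⊓ V ≤ U ∧ ¬ ((γ₁ • A) ⊓ V ≤ U) := by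
  classical
  obtain ⟨f₁, w₁, hw₁, -, hA₁, hdc₁⟩ := exists_rep_unr hι A ⊥ V hVo γ₁
  obtain ⟨f₂, w₂, hw₂, -, hA₂, hdc₂⟩ := exists_rep_unr hι A ⊥ V hVo γ₂
  rw [sup_bot_eq] at hdc₁ hdc₂
  have hδ : f₁⁻¹ * f₂ ∉ (Subgroup.zpowers (c (g := g) (⟨0, hr⟩ : Fin r)) : Set (PuncturedSurfaceGroup g r)) *
      (V.comap ι : Set _) := by
    intro hmem
    obtain ⟨a', ha', k, hk, hak⟩ := Set.mem_mul.mp hmem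
    apply hne
    rw [hdc₁, hdc₂]
    symm
    have hkV : ι k ∈ V := hk
    have haA : ι a' ∈ A := by rw [hA]; exact Subgroup.le_topologicalClosure _ (Subgroup.mem_map_of_mem ι ha')
    refine DoubleCoset.doubleCoset_eq_of_mem (DoubleCoset.mem_doubleCoset.mpr
      ⟨ι f₁ * ι a' * ι k * (ι f₁ * ι a')⁻¹, hVn.conj_mem _ hkV (ι f₁ * ι a'), ι a', haA, ?_⟩)
    have hf₂ : f₂ = f₁ * (a' * k) := by rw [hak, mul_inv_cancel_left]
    rw [hf₂, map_mul, map_mul]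
    group
  obtain ⟨U, hUo, hUV, hUn, hk, ha⟩ := cuspTwist_exists_open_separating hι hg hr hℓ hℓS V hVo f₁ f₂
    (Subgroup.zpowers (c (g := g) (⟨0, hr⟩ : Fin r))) (Or.inr ⟨rfl, hδ⟩)
  haveI := hUn
  refine ⟨U, hUo, hUV, hUn, ?_, ?_⟩
  · rw [hA₂, ← conjAct_smul_eq_of_subgroupOf_normal hUV hw₂, Subgroup.pointwise_smul_le_pointwise_smul_iff, hA]
    exact hk
  · rw [hA₁, ← conjAct_smul_eq_of_subgroupOf_normal hUV hw₁, Subgroup.pointwise_smul_le_pointwise_smul_iff, hA]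
    exact ha

/-- **Cusp alive, plain subgroup killed**: for `H ≤ Γ` generated by plain letters (`a_i, b_i (i < g − 1)`,
`c_j (j ≠ 0)`; e.g. `H = ⟨b_0⟩` when `g ≥ 2`) and `B = cl ι(H)`, every level cusp `Vγ₁cl ι⟨c_0⟩` is separated
from every `γ₂Bγ₂⁻¹`: an open `U ≤ V`, normal in `V`, with `γ₂Bγ₂⁻¹ ∩ V ≤ U` and `γ₁cl ι⟨c_0⟩γ₁⁻¹ ∩ V ⊄ U`.
[cite: MochizukiCombGC2007, Prop 1.2 proof p.9] -/
theorem cuspTwist_exists_open_separating_of_plain (hι : IsProSigmaCompletion Sigma ι) (hg : 1 ≤ g)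
    (hr : 1 ≤ r) {ℓ : ℕ} (hℓ : ℓ.Prime) (hℓS : ℓ ∈ Sigma)
    (A : Subgroup P) (hA : A = ((Subgroup.zpowers (c (g := g) (⟨0, hr⟩ : Fin r))).map ι).topologicalClosure)
    (H : Subgroup (PuncturedSurfaceGroup g r))
    (hH : H ≤ Subgroup.closure {s : PuncturedSurfaceGroup g r |
      (∃ i : Fin g, (i : ℕ) < g - 1 ∧ (s = a i ∨ s = b i)) ∨ ∃ j : Fin r, (j : ℕ) ≠ 0 ∧ s = c j})
    (B : Subgroup P) (hB : B = (H.map ι).topologicalClosure)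
    (V : Subgroup P) [hVn : V.Normal] (hVo : IsOpen (V : Set P)) (γ₁ γ₂ : ConjAct P) :
    ∃ U : Subgroup P, IsOpen (U : Set P) ∧ U ≤ V ∧ (U.subgroupOf V).Normal ∧
      (γ₂ • B) ⊓ V ≤ U ∧ ¬ ((γ₁ • A) ⊓ V ≤ U) := by
  classical
  obtain ⟨f₁, w₁, hw₁, -, hA₁, -⟩ := exists_rep_unr hι A ⊥ V hVo γ₁
  obtain ⟨f₂, w₂, hw₂, -, hB₂, -⟩ := exists_rep_unr hι B ⊥ V hVo γ₂
  obtain ⟨U, hUo, hUV, hUn, hk, ha⟩ := cuspTwist_exists_open_separating hι hg hr hℓ hℓS V hVo f₁ f₂ H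
    (Or.inl hH)
  haveI := hUn
  refine ⟨U, hUo, hUV, hUn, ?_, ?_⟩
  · rw [hB₂, ← conjAct_smul_eq_of_subgroupOf_normal hUV hw₂, Subgroup.pointwise_smul_le_pointwise_smul_iff, hB]
    exact hk
  · rw [hA₁, ← conjAct_smul_eq_of_subgroupOf_normal hUV hw₁, Subgroup.pointwise_smul_le_pointwise_smul_iff, hA]
    exact ha

end SemiGraphOfAnabelioids.IsProSigmaCompletion

end Literature.AnabelianGeometry.SemiGraphs
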